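import Summits.BirchSwinnertonDyer.Rank1Residual.X2.NonsplitCellCClass
import Summits.BirchSwinnertonDyer.Rank1Residual.X2.IsogenyClassStability
import HarnessLib

/-!
# O9 ∩ {non-split}, ψ EVEN (`CellCNonsplitNotGV`) at the CLASS LEVEL: `BSD(E,p)` from the three
# declared residuals c1–c3 + PUBLISHED facts — NO main-conjecture input (cell `bsd-eis`, seat
# `bsd-eis-cgshw` g4; route `EisensteinPrimes`, crux 4 `BSDpOnCellC`, line b1)

HONEST FRAMING (cell `bsd-eis`): theorems only; nothing booked; X2 stays CONSTRUCTION-SHAPED; no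
label moves. The sibling `X2/NonsplitCellCClass.lean` (p407684) gives `BSD(E,p)` on ALL of X2c ∩
{non-split} from c1 `HsiehFrameResidualAt`, c2 `NonsplitBDPValueOnTree`, c3 `NonsplitIMCEqOnTree`
(`X2/NonsplitBDPExists.lean`) + Mazur's main conjecture on X2b ∩ {non-split} (needed only at the CGLS
partner of a ψ-ODD pair) + published facts. This file records the ψ-EVEN sub-cell separately, where
the partner `E^{d_K}` has the Greenberg–Vatsal parity and so lies in the CLOSED sub-cell X2a
(`pPartRankZero_twist_of_not_gvPar`, `X2/RankOne.lean`): on `CellCNonsplitNotGV` (2 552 @3, 93 @5,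
17 @7 classes, GVPAR-SUMMARY) the inputs are exactly c1 ∧ c2 ∧ c3 + PUBLISHED facts — crux 3 of the
route is not touched. The Manin condition is moved to the `X₀(N)`-optimal curve as in the sibling;
`¬GVPar` passes along the isogeny by `gvPar_iff_of_isIsogenous_of_mult` (`X2/IsogenyClassStability.lean`,
granted the two Tate-uniformisation facts of Silverman *ATAEC* V.5.3 / V.5.4).

* `bsdp_of_cellC_of_not_split_of_manin_of_residuals_of_partner` — the pointwise (b1) packaging with
  the partner's rank-zero `p`-part as a SUPPLY (shape of `X2.bsdp_of_cellC_of_manin_of_partner`).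
* `bsdp_of_cellCNonsplitNotGV_of_residuals` — the class-level ψ-even statement.

References: [CastellaEtAl2021] Thm. 5.3.1; [GreenbergVatsal2000] Thm. (1.3), §2 p. 28;
[SilvermanATAEC1994] V.5.3–5.4; [Hsieh2014] Thm. 1; [KellerYin2024] Thm. D (PRE); [Mazur1978]
Cor. 4.1; [Gross1991] (1.1); [Miller2011LMS] Def. 1.1.
-/

set_option autoImplicit false

noncomputable section

open scoped Classical MatrixGroups ModularForm

open CongruenceSubgroup WeierstrassCurve NumberField IsDedekindDomain Field PowerSeries
  Literature.NumberTheory.EllipticCurves Literature.NumberTheory.EllipticCurves.GreenbergSelmer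
  Literature.NumberTheory.EllipticCurves.ModularForms Literature.NumberTheory.QuadraticFields
  Literature.NumberTheory.EllipticCurves.Rank1Residual
  Literature.NumberTheory.EllipticCurves.Rank1Residual.Typed
  Literature.NumberTheory.EllipticCurves.KrizLi2019
  Literature.NumberTheory.EllipticCurves.GreenbergVatsal2000
  Literature.NumberTheory.EllipticCurves.Wuthrich2014
  Literature.NumberTheory.EllipticCurves.SteinWuthrich2013
  Literature.NumberTheory.GaloisRepresentations Literature.NumberTheory.GaloisCohomology
  Literature.NumberTheory.Automorphic
  Summit.BirchSwinnertonDyer.Rank1Residual.X11b.AcSelmer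
  Summit.BirchSwinnertonDyer.Rank1Residual.X11b.Halves
  Summit.BirchSwinnertonDyer.Rank1Residual.X11b

namespace Summit.BirchSwinnertonDyer.Rank1Residual.X2

/-! ### The ψ-even sub-cell `CellCNonsplitNotGV`: no main-conjecture input at all -/

section NotGV

variable (W : WeierstrassCurve ℚ) [W.IsElliptic] [W.IsGloballyMinimal] (p : ℕ) [Fact p.Prime]

/-- **Pointwise, partner-supply form.** As `bsdp_of_cellC_of_not_split_of_manin_of_residuals`, but
with the partner's rank-zero `p`-part taken as a SUPPLY over all admissible `K` and all globally
minimal models of the twist (`hpartner`, the shape of `X2.bsdp_of_cellC_of_manin_of_partner`)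
instead of Mazur's main conjecture on X2b ∩ {non-split}; every Heegner datum of the (b1) road is
produced in the same way (Hoffstein–Luo field, Heegner datum and `K`-rational point, non-torsion by
Gross–Zagier, Néron model of the twist with `twistTransportPackage_holds`, `htamK` by
`padicValNat_tamagawaProduct_baseChange_of_heegner_odd`, anticyclotomic `ℤ_p`-extension, generator,
degree-one prime), then p404431's `bsdp_of_cellC_of_not_split_of_hsieh2014_of_halvesOnTree_of_partner`.
CONDITIONAL on every listed binder; nothing booked. [cite: CastellaEtAl2021, Thm. 5.3.1 and (5.5)–(5.7)]
[cite: Hsieh2014, Thm. 1 (arXiv:1112.1580 pp. 3–4)] [claim: KellerYin2024, status: under-review]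
[cite: Gross1991, (1.1)] [cite: Miller2011LMS, Def. 1.1] -/
theorem bsdp_of_cellC_of_not_split_of_manin_of_residuals_of_partner
    (hnf : exists_isNewformOf)
    (hPT : ∀ (K : Type) [Field K] [NumberField K], poitouTate_selmerStructure_duality K)
    (hPT2 : ∀ (K : Type) [Field K] [NumberField K], poitouTate_sha_tateDual K)
    (hEP : ∀ (K : Type) [Field K] [NumberField K] (v : HeightOneSpectrum (𝓞 K)),
      localEulerPoincareCharacteristic (v.adicCompletion K))
    (hcd : fieldCdLE_two_of_numberField)
    (hBr : ∀ (K : Type) [Field K] [NumberField K] (p : ℕ) [Fact p.Prime],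
      ZpExtension.decomp_not_le_kerSubgroup_of_isAnticyclotomic K p)
    (hH : hsieh2014_exists_anticyclotomicPAdicLFunction)
    (hGZ : ∀ (N : ℕ) [NeZero N] (W : WeierstrassCurve ℚ) (K : Type) [Field K] [NumberField K],
      gross_zagier N W K)
    (hKo : ∀ (N : ℕ) [NeZero N] (W : WeierstrassCurve ℚ) (K : Type) [Field K] [NumberField K],
      kolyvagin N W K)
    (hHP : ∀ (N : ℕ) [NeZero N] (W : WeierstrassCurve ℚ) (K : Type) [Field K] [NumberField K],
      heegnerPointComplex_mem_range_map N W K)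
    (hGZK : rank_eq_analyticRank_of_analyticRank_le_one)
    (hHL : HoffsteinLuo1997_exists_twist_L_one_ne_zero)
    (hc : CellC W p) (hns : ¬ W.HasSplitMultiplicativeReductionAtPrime p)
    (hMan : HasPrimeToManinDatum W p)
    (hres : HsiehFrameResidualAt W p) (h2 : NonsplitBDPValueOnTree W p)
    (h3 : NonsplitIMCEqOnTree W p)
    (hpartner : ∀ (K : Type) [Field K] [NumberField K], IsImaginaryQuadratic K →
        Odd (NumberField.discr K) → NumberField.discr K < -4 →
        SatisfiesHeegnerHypothesis (W.conductorNorm ℤ) K → SatisfiesHeegnerHypothesis p K →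
        (W.quadraticTwist (NumberField.discr K : ℚ)).entireLFunction 1 ≠ 0 →
      ∀ (Wd : WeierstrassCurve ℚ) [Wd.IsElliptic] [Wd.IsGloballyMinimal],
        (∃ C : VariableChange ℚ, C • Wd = W.quadraticTwist (NumberField.discr K : ℚ)) →
        Wd.analyticRank = 0 → PPartRankZero Wd p) :
    BSDp W p := by
  have hp : p.Prime := Fact.out
  have hmod : hasEntireLFunction_rat := WeierstrassCurve.hasEntireLFunction_rat_of_exists_isNewformOf hnf
  obtain ⟨hr, hp2, hred, hmult⟩ := hc
  haveI : NeZero (W.conductorNorm ℤ) := ⟨(W.conductorNorm_pos_holds).ne'⟩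
  -- `w(E) = -1`
  have hw : W.rootNumber = -1 := by
    rw [WeierstrassCurve.rootNumber_eq_neg_one_pow_analyticRank_of_exists_isNewformOf hnf W, hr]
    norm_num
  -- the admissible auxiliary field
  obtain ⟨K, _, _, hK, hodd, hlt, hHN, hHp, hLK⟩ :=
    exists_admissibleField_of_rootNumber_eq_neg_one hnf hHL W hw p
  -- the datum with `p ∤ c`, a Heegner datum and the `K`-rational Heegner point
  obtain ⟨Dt, hcM⟩ := hMan
  obtain ⟨β, hβ⟩ := exists_dvd_sq_sub_discr_holds (W.conductorNorm ℤ) K hK hHN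
  obtain ⟨H, -⟩ := nonempty_heegnerDatum_holds (W.conductorNorm ℤ) K hK hβ
  obtain ⟨ι⟩ : Nonempty (K →+* ℂ) := inferInstance
  obtain ⟨P, hP⟩ := hHP (W.conductorNorm ℤ) W K hK hHN Dt H ι
  -- the Heegner point has infinite order: `L'(E/K,1) = L'(E,1)·L(E^K,1) ≠ 0` (Gross–Zagier)
  have hL0 : W.entireLFunction 1 = 0 := entireLFunction_one_eq_zero_of_analyticRank_eq_one hr
  obtain ⟨-, hderiv⟩ := leadingLCoeff_eq_deriv_of_analyticRank_eq_one hr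
  have hLKd : LDerivEK W K ≠ 0 := by
    rw [lDerivEK_eq_deriv_mul W K hmod hL0]
    exact mul_ne_zero hderiv hLK
  have hPH : IsHeegnerPoint (W.conductorNorm ℤ) W K P := ⟨Dt, H, ι, hP⟩
  have hPinf : ¬ IsOfFinAddOrder P :=
    (lDerivEK_ne_zero_iff_not_isOfFinAddOrder W (W.conductorNorm ℤ) K (hGZ _ W K) hK hHN hPH).mp hLKd
  -- a globally minimal model of the twist (Néron) and its transport values
  have hD0 : (NumberField.discr K : ℚ) ≠ 0 := by exact_mod_cast NumberField.discr_ne_zero K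
  haveI hEt : (W.quadraticTwist (NumberField.discr K : ℚ)).IsElliptic :=
    W.isElliptic_quadraticTwist hD0
  obtain ⟨Cd, hCd⟩ := hasGlobalMinimalModel_rat_holds (W.quadraticTwist (NumberField.discr K : ℚ))
  set Wd : WeierstrassCurve ℚ := Cd • W.quadraticTwist (NumberField.discr K : ℚ) with hWd_def
  haveI : Wd.IsGloballyMinimal := hCd
  have hWd : Cd • W.quadraticTwist (NumberField.discr K : ℚ) = Wd := rfl
  have hC : Cd⁻¹ • Wd = W.quadraticTwist (NumberField.discr K : ℚ) := by
    rw [← hWd, inv_smul_smul]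
  obtain ⟨htam, hu⟩ := twistTransportPackage_holds W p K Wd Cd ⟨hr, hp2, hred, hmult⟩ hK hodd hHN hWd
  have htamK : padicValNat p (W.baseChange K).tamagawaProduct = 2 * padicValNat p W.tamagawaProduct :=
    padicValNat_tamagawaProduct_baseChange_of_heegner_odd W p hp2 K hK hodd hHN hHp
  -- the twist has analytic rank `0`; its rank-zero `p`-part from the supply
  have hLd : Wd.entireLFunction 1 ≠ 0 := by
    rw [← hWd, entireLFunction_smul]; exact hLK
  have hrd : Wd.analyticRank = 0 := (Wd.analyticRank_eq_zero_iff_holds (hmod _)).2 hLd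
  have htw : PPartRankZero Wd p := hpartner K hK hodd hlt hHN hHp hLK Wd ⟨Cd⁻¹, hC⟩ hrd
  -- the anticyclotomic `ℤ_p`-extension, a topological generator, a degree-one prime above `p`
  haveI : IsTotallyComplex K := hK.2
  obtain ⟨κ, hκ⟩ := ZpExtension.exists_isAnticyclotomic_holds (K := K) (p := p) hK.1
    (fun w ↦ IsTotallyComplex.isComplex w)
  obtain ⟨γ, hγ⟩ := κ.surjective (Multiplicative.ofAdd 1)
  haveI : Fact (κ.IsTopGenerator γ) := ⟨hγ⟩
  obtain ⟨𝔭, h𝔭, he, hf⟩ := X11b.exists_degreeOnePrime_of_splitsIn K p hK.1 (hHp p hp dvd_rfl)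
  -- conclude by the (b1) road
  exact bsdp_of_cellC_of_not_split_of_hsieh2014_of_halvesOnTree_of_partner W p hnf hPT hPT2 hEP hcd
    hBr hH (W.conductorNorm ℤ) K Dt H ι P (hGZ _ W K) (hKo _ W K) hGZK ⟨hr, hp2, hred, hmult⟩ hns rfl
    hK hlt hHN hHp hP hPinf hcM hLK Wd Cd hWd htw htam hu htamK κ hκ γ 𝔭 h𝔭 he hf hres h2 h3

end NotGV

section NotGVClass

/-- **The ψ-even non-split sub-cell `CellCNonsplitNotGV` (2 552 @3, 93 @5, 17 @7 classes) at the
CLASS LEVEL from c1 ∧ c2 ∧ c3 + PUBLISHED facts — NO main-conjecture input.** For every rank-one X2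
pair at a NON-split `p` with `¬ GVPar W p`: `BSD(E,p)`, given the published named facts (incl. the two
Tate-uniformisation facts `hT`, `hT'` of Silverman *ATAEC* V.5.3/5.4 that make the Greenberg–Vatsal
parity an isogeny invariant at a multiplicative prime, `gvPar_iff_of_isIsogenous_of_mult`) and the
three declared residuals at every non-split CellC pair. The CGLS partner `E^{d_K}` of a ψ-even pair
has the Greenberg–Vatsal parity and lies in the CLOSED sub-cell X2a (`pPartRankZero_twist_of_not_gvPar`:
Greenberg–Vatsal + Wuthrich + Stein–Wuthrich + Greenberg–Stevens, published), so crux 3 of route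
`EisensteinPrimes` is not touched; the Manin condition is moved to the optimal curve
(`bsdp_of_cellC_of_forall_isIsogenous`; CellC, non-splitness and `¬GVPar` are isogeny invariants).
CONDITIONAL on every listed binder; nothing booked; X2 CONSTRUCTION-SHAPED; no label change.
[cite: CastellaEtAl2021, Thm. 5.3.1] [cite: GreenbergVatsal2000, Thm. (1.3) and §2 p. 28]
[cite: SilvermanATAEC1994, Thm. V.5.3 and Cor. V.5.4] [cite: Mazur1978, Cor. 4.1]
[cite: Hsieh2014, Thm. 1 (arXiv:1112.1580 pp. 3–4)] [claim: KellerYin2024, status: under-review]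
[cite: Miller2011LMS, Def. 1.1] -/
theorem bsdp_of_cellCNonsplitNotGV_of_residuals
    (hGV : lambdaMu_multiplicative_of_gvPar) (hWu : thm16_charIdeal_dvd_multiplicative_of_reducible)
    (hJs : thm61_splitMultiplicative) (hJn : thm61_nonsplitMultiplicative)
    (hHs : exists_isSplitMultCanonical) (hHn : exists_isMultCanonical)
    (hpar : nonempty_modularParametrizationData)
    (hGS : ∀ (W : WeierstrassCurve ℚ) [W.IsElliptic] [W.IsGloballyMinimal] (p : ℕ) [Fact p.Prime],
      greenberg_stevens (W := W) (p := p))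
    (hnf : exists_isNewformOf)
    (hPT : ∀ (K : Type) [Field K] [NumberField K], poitouTate_selmerStructure_duality K)
    (hPT2 : ∀ (K : Type) [Field K] [NumberField K], poitouTate_sha_tateDual K)
    (hEP : ∀ (K : Type) [Field K] [NumberField K] (v : HeightOneSpectrum (𝓞 K)),
      localEulerPoincareCharacteristic (v.adicCompletion K))
    (hcd : fieldCdLE_two_of_numberField)
    (hBr : ∀ (K : Type) [Field K] [NumberField K] (p : ℕ) [Fact p.Prime],
      ZpExtension.decomp_not_le_kerSubgroup_of_isAnticyclotomic K p)
    (hH : hsieh2014_exists_anticyclotomicPAdicLFunction)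
    (hGZ : ∀ (N : ℕ) [NeZero N] (W : WeierstrassCurve ℚ) (K : Type) [Field K] [NumberField K],
      gross_zagier N W K)
    (hKo : ∀ (N : ℕ) [NeZero N] (W : WeierstrassCurve ℚ) (K : Type) [Field K] [NumberField K],
      kolyvagin N W K)
    (hHP : ∀ (N : ℕ) [NeZero N] (W : WeierstrassCurve ℚ) (K : Type) [Field K] [NumberField K],
      heegnerPointComplex_mem_range_map N W K)
    (hGZK : rank_eq_analyticRank_of_analyticRank_le_one)
    (hHL : HoffsteinLuo1997_exists_twist_L_one_ne_zero)
    (hEd : edixhoven_optimalManinConstant_integral) (hMaz : mazur_not_dvd_maninConstant_of_odd)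
    (hCassels : bsdRHS_eq_of_isIsogenous)
    (hT : Silverman1994_thmV53_tateUniformisation.{0})
    (hT' : Silverman1994_thmV53_corV54_tateUniformisation.{0})
    (hres : ∀ (W : WeierstrassCurve ℚ) [W.IsElliptic] [W.IsGloballyMinimal] (p : ℕ) [Fact p.Prime],
      CellC W p → ¬ W.HasSplitMultiplicativeReductionAtPrime p → HsiehFrameResidualAt W p)
    (h2 : ∀ (W : WeierstrassCurve ℚ) [W.IsElliptic] [W.IsGloballyMinimal] (p : ℕ) [Fact p.Prime],
      CellC W p → ¬ W.HasSplitMultiplicativeReductionAtPrime p → NonsplitBDPValueOnTree W p)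
    (h3 : ∀ (W : WeierstrassCurve ℚ) [W.IsElliptic] [W.IsGloballyMinimal] (p : ℕ) [Fact p.Prime],
      CellC W p → ¬ W.HasSplitMultiplicativeReductionAtPrime p → NonsplitIMCEqOnTree W p)
    (W : WeierstrassCurve ℚ) [W.IsElliptic] [W.IsGloballyMinimal] (p : ℕ) [Fact p.Prime]
    (hc : CellCNonsplitNotGV W p) : BSDp W p := by
  obtain ⟨hcC, hns, hnot⟩ := hc
  have hmod : hasEntireLFunction_rat := WeierstrassCurve.hasEntireLFunction_rat_of_exists_isNewformOf hnf
  refine bsdp_of_cellC_of_forall_isIsogenous hEd hMaz hCassels hpar hnf hGZK W p hcC ?_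
  intro W₀ _ _ hiso hc₀ hMan₀
  have hns₀ : ¬ W₀.HasSplitMultiplicativeReductionAtPrime p := fun h ↦
    hns (IsogenyQuotientLine.hasSplitMultiplicativeReductionAtPrime_of_isIsogenous
      hiso.symm_of_charZero h)
  have hnot₀ : ¬ GVPar W₀ p := fun h ↦
    hnot ((gvPar_iff_of_isIsogenous_of_mult hT hT' hcC.2.1 hcC.2.2.2 hiso).mpr h)
  exact bsdp_of_cellC_of_not_split_of_manin_of_residuals_of_partner W₀ p hnf hPT hPT2 hEP hcd hBr hH
    hGZ hKo hHP hGZK hHL hc₀ hns₀ hMan₀ (hres W₀ p hc₀ hns₀) (h2 W₀ p hc₀ hns₀) (h3 W₀ p hc₀ hns₀)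
    (fun K _ _ hK _ _ _ hHp _ Wd _ _ hWd hrd ↦
      pPartRankZero_twist_of_not_gvPar hGV hWu hJs hJn hHs hHn hGZK hmod hpar hGS W₀ p hc₀.2 hnot₀ K
        hK hHp Wd hWd hrd)

end NotGVClass

end Summit.BirchSwinnertonDyer.Rank1Residual.X2

end
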